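import Mathlib
import Summits.Ventures.HodgeRepro2.LevelPositivity

/-!
# T6B5Data — Tier 6, sub-goal B5 («single-level positivity + level»): the carriers

The objects of Liu, *Fourier–Jacobi cycles and arithmetic relative trace formula*, Cambridge J. Math. 9
(2021), §4.2–§4.3 (journal page layer `paper:liu2021-fourier-jacobi-cycles-arithmetic-relative-trace-formula`,
page `p00NN` = journal page NN), carried as DATA ONLY: a bundle `LiuAlbaneseData` with no `Prop` field.
Every printed property of these objects is a displayed hypothesis in `T6B5Hyp.lean`
(`Summit.Ventures.HodgeRepro2.T6.Hyp.*`), consumed by name in `B5_main` (`T6B5Main.lean`).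

Conventions (TIER4 §B5): Liu's `E` = the Galois CM field `F`, Liu's `F` = `F⁺`; `G(A_F^∞)` = the finite-adèlic
points of `G = U(V)`; the journal layer drops tildes — Liu's `M̃_μ` (the number field generated by the values
of `μ^alg`, p0041 ll. 45–49) is carried here as `Mt`.
README §8(d): uses an L-value-free non-vanishing device: NO.
-/

namespace Summit.Ventures.HodgeRepro2.T6.B5Data

open Summit.Ventures.HodgeRepro2.LevelPositivity

/-- The carriers of Liu 2021 §4.2–§4.3 (data only; printed symbol ↦ field, locators in the field docstrings).
No field is a `Prop`: every printed property is a displayed hypothesis of `T6B5Hyp.lean`. -/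
structure LiuAlbaneseData where
  /-- `n`, the rank of the totally definite incoherent hermitian space `V` over `A_E`
  («Let n ⩾ 2 be an integer. Let V be a totally definite incoherent hermitian space over A_E of rank n», p0045 ll. 46–47). -/
  n : ℕ
  /-- `G(A_F^∞)`: the finite-adèlic points of `G := U(V)` («the unitary group of V, which is a reductive group over A_F»,
  p0045 ll. 51–52), carried as a topological group (a td group: Getz–Hahn Lemma 5.1.1). -/
  G : Type
  [instGroup : Group G]
  [instTop : TopologicalSpace G]
  [instTG : IsTopologicalGroup G]
  /-- «neat» as an elementwise condition on `k ∈ K` (Bergeron–Millson–Moeglin 2016 §1.4; TIER4 §B5 E15). -/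
  neat : G → Prop
  /-- Membership of an open compact subgroup `K` in the index set of the projective system `{Sh(V)_K}_K`
  («indexed by sufficiently small open compact subgroups K of G(A_F^∞)», p0045 ll. 52–54; Prop. C.5 p0109 ll. 18–22). -/
  IsIndex : OpenSubgroup G → Prop
  /-- The conjugate symplectic automorphic characters `μ` of weight one (Def. 4.11 first bullet p0046 ll. 33–37;
  Def. 4.3(1) p0041 ll. 32–34), with the action of `Gal(ℂ/ℚ) = Aut(ℂ/ℚ)` through `μ^alg` used in Cor. 4.20
  («representatives of Gal(ℂ/ℚ)-orbits», p0054 l. 73). -/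
  Char : Type
  [instGal : MulAction (ℂ ≃ₐ[ℚ] ℂ) Char]
  /-- For `μ`, the pairs `(ε, χ)` with `ε` `μ`-admissible: the second and third bullets of Def. 4.11
  (p0046 ll. 38–49) and Def. 4.12 (p0047 ll. 5–8) — the index set of the sums in Thm. 4.18 and Cor. 4.20
  («taken over all ε, χ such that ε is μ-admissible»). -/
  Pair : Char → Type
  /-- The underlying `ℂ`-vector space of the adèlic oscillator representation `ω(μ, ε, χ)` (p0046 ll. 50–61). -/
  W : (μ : Char) → Pair μ → Type
  [instWacg : ∀ μ p, AddCommGroup (W μ p)]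
  [instWmod : ∀ μ p, Module ℂ (W μ p)]
  /-- `ω(μ, ε, χ) := ⊗_v ω(μ_v, ε_v, χ_v)`, the adèlic oscillator representation of `G(A_F^∞)` (p0046 ll. 56–61). -/
  ω : (μ : Char) → (p : Pair μ) → Representation ℂ G (W μ p)
  /-- `M̃_μ ⊆ ℂ`, «the subfield generated by values μ^alg(x) for x ∈ (A_E^∞)^×» (p0041 ll. 45–49; the journal layer
  prints it without the tilde — arXiv TeX layer `paper:arxiv-2102.11518` p0018 l. 48). -/
  Mt : Char → IntermediateField ℚ ℂ
  /-- `Ω(μ)` of Def. 4.16 (p0052 ll. 6–33): an `M̃_μ`-vector space on which `G(A_F^∞)` acts `M̃_μ`-linearly;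
  its `ℚ`-structure is the restriction of scalars (`IsScalarTower ℚ M̃_μ Ω(μ)`). -/
  Omega : Char → Type
  [instOacg : ∀ μ, AddCommGroup (Omega μ)]
  [instOmod : ∀ μ, Module (Mt μ) (Omega μ)]
  [instOq : ∀ μ, Module ℚ (Omega μ)]
  [instOtower : ∀ μ, IsScalarTower ℚ (Mt μ) (Omega μ)]
  /-- The action of `G(A_F^∞)` on `Ω(μ)` («G(A_F^∞) acts M̃_μ-linearly via its action on A_∞», p0052 ll. 11–19). -/
  ρΩ : (μ : Char) → Representation (Mt μ) G (Omega μ)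
  /-- The objects `D_μ = (A_μ, i_μ, λ_μ, r_μ)` of the category `A(μ)` (Def. 4.5, p0042 ll. 8–20). -/
  Obj : Char → Type
  /-- Abelian varieties over `E` (the carrier of Cor. 4.20's «isogeny decomposition … of abelian varieties over E»,
  p0054 ll. 52–72). -/
  AbVar : Type
  /-- The relation «isogenous» `∼` between abelian varieties over `E` (p0054 l. 53). -/
  Isog : AbVar → AbVar → Prop
  /-- Finite products of abelian varieties over `E` (the `∏_μ A_μ^{d(μ,K)}` of p0054 ll. 56–60). -/
  prodAV : {ι : Type} → [Fintype ι] → (ι → AbVar) → AbVar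
  /-- `A_K := Alb_{X_K}`, the Albanese variety of `X_K` (p0046 l. 10). -/
  A_K : OpenSubgroup G → AbVar
  /-- The abelian variety `A_μ` of an object `D_μ ∈ A(μ)` (p0042 l. 9). -/
  Aμ : (μ : Char) → Obj μ → AbVar
  /-- `Hom_E(A_K, A_μ)_ℚ` (p0052 l. 49), as a `ℚ`-vector space. -/
  HomQ : OpenSubgroup G → (μ : Char) → Obj μ → Type
  [instHacg : ∀ K μ D, AddCommGroup (HomQ K μ D)]
  [instHmod : ∀ K μ D, Module ℚ (HomQ K μ D)]

attribute [instance] LiuAlbaneseData.instGroup LiuAlbaneseData.instTop LiuAlbaneseData.instTG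
  LiuAlbaneseData.instGal LiuAlbaneseData.instWacg LiuAlbaneseData.instWmod LiuAlbaneseData.instOacg
  LiuAlbaneseData.instOmod LiuAlbaneseData.instOq LiuAlbaneseData.instOtower LiuAlbaneseData.instHacg
  LiuAlbaneseData.instHmod

section Admissible

variable {G : Type*} [Group G] [TopologicalSpace G] {k : Type*} [Field k] {V : Type*} [AddCommGroup V]
  [Module k V]

/-- «admissible» (Getz–Hahn, GTM 300, Def. 5.4; TIER4 §B5 (a.11)/E14): smooth (every stabiliser open — the
accepted `IsSmooth`, Def. 5.3) and `V^K` finite-dimensional for every compact open subgroup `K`. -/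
def IsAdmissible (ρ : Representation k G V) : Prop :=
  IsSmooth ρ ∧ ∀ K : OpenSubgroup G, IsCompact (K : Set G) → FiniteDimensional k (invariants ρ K)

end Admissible

variable (𝓛 : LiuAlbaneseData)

/-- Cor. 4.20's integer `d(μ, K) := Σ_ε Σ_χ dim_ℂ ω(μ, ε, χ)^K, where the sum is taken over all ε, χ such that ε is
μ-admissible` (p0055 ll. 10–17), as a finite sum over the index type `Pair μ` (Mathlib's `finsum`; that the support
is finite — «the integer d(μ, K)» — is part of the display `Hyp.Liu2021_Cor4_20`). -/
noncomputable def dLiu (μ : 𝓛.Char) (K : OpenSubgroup 𝓛.G) : ℕ :=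
  ∑ᶠ p : 𝓛.Pair μ, Module.finrank ℂ (invariants (𝓛.ω μ p) K)

/-- `R` is a set of «representatives of Gal(ℂ/ℚ)-orbits» (p0054 l. 73) for the product of Cor. 4.20 at level `K`:
it meets each orbit at most once, and it meets every orbit carrying a non-zero exponent `d(μ, K)` (the orbits with
`d(μ, K) = 0` contribute the trivial factor `A_μ^0` and need no representative). -/
def IsRepSet (K : OpenSubgroup 𝓛.G) (R : Finset 𝓛.Char) : Prop :=
  (∀ μ ∈ R, ∀ μ' ∈ R, (∃ σ : ℂ ≃ₐ[ℚ] ℂ, σ • μ = μ') → μ = μ') ∧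
    ∀ μ : 𝓛.Char, dLiu 𝓛 μ K ≠ 0 → ∃ μ' ∈ R, ∃ σ : ℂ ≃ₐ[ℚ] ℂ, σ • μ = μ'

/-- The right-hand side `∏_μ A_μ^{d(μ,K)}` of Cor. 4.20 (p0054 ll. 53–60) for the objects `D_μ` and the
representatives `R`: the product over the pairs (representative `μ`, copy `< d(μ, K)`) of `A_μ`. -/
noncomputable def decompTarget (D : ∀ μ, 𝓛.Obj μ) (K : OpenSubgroup 𝓛.G) (R : Finset 𝓛.Char) : 𝓛.AbVar :=
  𝓛.prodAV (fun x : (Σ μ : R, Fin (dLiu 𝓛 μ K)) => 𝓛.Aμ x.1.1 (D x.1.1))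

/-- The conclusion of TIER4 Theorem B5.1 (i)–(v) + Corollary B5.2 at the level `K`, for the four characters `μ i`
with objects `D`: every open compact `K' ≤ K` is in the index set (i), carries the «integer» `d(·, K')` (finite
support), has `d(μ i, K') ≥ 1` (ii), antitone counts below `K` (iii), the Hom-form
`[M̃_μ : ℚ]·d(μ, K') = dim_ℚ Hom_E(A_{K'}, A_μ)_ℚ` and `Hom_E(A_{K'}, A_{μ_i})_ℚ ≠ 0` (iv), orbit-invariance of
the exponents (v), and the isogeny decomposition of Cor. 4.20 at `K'` (Cor. B5.2). -/
structure B5Conclusion (μ : Fin 4 → 𝓛.Char) (D : ∀ ν, 𝓛.Obj ν) (K : OpenSubgroup 𝓛.G) : Prop where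
  /-- the level is compact (and open). -/
  compact : IsCompact (K : Set 𝓛.G)
  /-- (i) every open compact `K' ≤ K` is in the index set of the tower. -/
  index : ∀ K' : OpenSubgroup 𝓛.G, IsCompact (K' : Set 𝓛.G) → K' ≤ K → 𝓛.IsIndex K'
  /-- «the integer d(μ, K')»: the sum defining `d(ν, K')` has finite support, for every `ν`. -/
  integer : ∀ K' : OpenSubgroup 𝓛.G, IsCompact (K' : Set 𝓛.G) → K' ≤ K → ∀ ν : 𝓛.Char,
    (Function.support fun p : 𝓛.Pair ν => Module.finrank ℂ (invariants (𝓛.ω ν p) K')).Finite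
  /-- (ii) single-level positivity `d(μ_i, K') ≥ 1`. -/
  positivity : ∀ K' : OpenSubgroup 𝓛.G, IsCompact (K' : Set 𝓛.G) → K' ≤ K → ∀ i, 1 ≤ dLiu 𝓛 (μ i) K'
  /-- (iii) the counts are antitone below `K`. -/
  mono : ∀ K' : OpenSubgroup 𝓛.G, IsCompact (K' : Set 𝓛.G) → K' ≤ K →
    ∀ K'' : OpenSubgroup 𝓛.G, IsCompact (K'' : Set 𝓛.G) → K'' ≤ K' → ∀ i, dLiu 𝓛 (μ i) K' ≤ dLiu 𝓛 (μ i) K''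
  /-- (iv) the Hom-form `[M̃_{μ_i} : ℚ] · d(μ_i, K') = dim_ℚ Hom_E(A_{K'}, A_{μ_i})_ℚ`. -/
  homForm : ∀ K' : OpenSubgroup 𝓛.G, IsCompact (K' : Set 𝓛.G) → K' ≤ K → ∀ i,
    Module.finrank ℚ (𝓛.Mt (μ i)) * dLiu 𝓛 (μ i) K' = Module.finrank ℚ (𝓛.HomQ K' (μ i) (D (μ i)))
  /-- (iv) «in particular» `Hom_E(A_{K'}, A_{μ_i})_ℚ ≠ 0`. -/
  homNe : ∀ K' : OpenSubgroup 𝓛.G, IsCompact (K' : Set 𝓛.G) → K' ≤ K → ∀ i,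
    Nontrivial (𝓛.HomQ K' (μ i) (D (μ i)))
  /-- (v) `d(σ·μ_i, K') = d(μ_i, K') ≥ 1` for every `σ ∈ Aut(ℂ/ℚ)`. -/
  orbit : ∀ K' : OpenSubgroup 𝓛.G, IsCompact (K' : Set 𝓛.G) → K' ≤ K → ∀ i (σ : ℂ ≃ₐ[ℚ] ℂ),
    dLiu 𝓛 (σ • μ i) K' = dLiu 𝓛 (μ i) K' ∧ 1 ≤ dLiu 𝓛 (σ • μ i) K'
  /-- Cor. B5.2: the isogeny decomposition of Cor. 4.20 at `K'`, for every set of representatives. -/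
  decomp : ∀ K' : OpenSubgroup 𝓛.G, IsCompact (K' : Set 𝓛.G) → K' ≤ K → ∀ R : Finset 𝓛.Char,
    IsRepSet 𝓛 K' R → 𝓛.Isog (𝓛.A_K K') (decompTarget 𝓛 D K' R)

end Summit.Ventures.HodgeRepro2.T6.B5Data
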